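import Literature.Probability.NegativeDependence.StronglyRayleighNegativeAssociation
import Literature.Combinatorics.StablePolynomials.RayleighOfStable
import HarnessLib

/-!
# Rayleigh measures, the class PHR, and "PHR ⇒ CNA+" (Borcea–Brändén–Liggett, Def. 2.5, Def. 2.6,
# Prop. 2.1 (1), (3), (4), Thm. 4.10)

J. Borcea, P. Brändén, T. M. Liggett, *Negative dependence and the geometry of polynomials*, J. Amer. Math.
Soc. 22 (2009) 521–567 (arXiv:0707.2340, held `paper:arxiv-0707.2340`; numbering of the arXiv version).
Verbatim (§2.1, arXiv pp. 6–7; §4, p. 15; §4.2, pp. 16–17):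

> **Definition 2.5.** A polynomial `f ∈ 𝔓_n` is called a *Rayleigh polynomial* if
> `∂f/∂z_i (x) ∂f/∂z_j (x) ≥ ∂²f/∂z_i∂z_j (x) f(x)` for all `x = (x_1,…,x_n) ∈ ℝ_+^n` and `1 ≤ i,j ≤ n`, where as
> usual `ℝ_+ = (0,∞)`. More generally, a multi-affine polynomial in `ℝ[z_1,…,z_n]` with non-negative coefficients
> is called a Rayleigh polynomial if it satisfies the above condition. A measure `μ ∈ 𝔓_n` is said to be a
> *Rayleigh measure* if its generating polynomial `g_μ` is Rayleigh.
>
> **Proposition 2.1.** If `f(z_1,…,z_n)` is Rayleigh then so are the following polynomials: (1) `∂^S f(z_1,…,z_n)`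
> for any `S ⊆ [n]`; […] (3) `f(z_1,…,z_n)|_{z_i = α_i}` for any `α_i ≥ 0`, `1 ≤ i ≤ n`; (4) `f(a_1 z_1,…,a_n z_n)`
> for all `a_i ≥ 0`, `i ∈ [n]`; […]. To prove (1) note that by induction it is enough to do it for `S = {i}` and
> arbitrary `i ∈ [n]`. This follows by first writing `f(z_1,…,z_n) = z_i ∂_i f(z_1,…,z_n) + f(z_1,…,z_n)|_{z_i=0}`
> and then letting `z_i → ∞` in the Rayleigh inequalities for `f` corresponding to pairs of variables indexed
> by distinct `j, k ∈ [n] ∖ {i}`.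
>
> **Definition 2.6.** A *homogeneous Rayleigh measure* is one whose generating polynomial is homogeneous and
> Rayleigh. The set of all measures that are projections of homogeneous Rayleigh measures is denoted by PHR.
>
> (§2.1, Def. 2.7) […] `μ` is called *strongly conditionally negatively associated* or CNA+ if each measure
> obtained from `μ` by imposing external fields and projections is CNA. (Remark 2.4) […] In §4.2 and §7 below
> we show that PHR ⇒ CNA+ and that this implication is strict.
>
> (§4) **Theorem 4.1.** Let `g ∈ ℝ[z_1,…,z_n]` be a multi-affine polynomial. Then `g` is stable if and only if
> `∂g/∂z_i (x) ∂g/∂z_j (x) ≥ ∂²g/∂z_i∂z_j (x) g(x)` for any `x ∈ ℝ^n` and `i, j ∈ [n]`. […] Clearly, a strongly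
> Rayleigh measure is automatically Rayleigh. (§4.1) The following theorem shows that the symmetric
> homogenization of any strongly Rayleigh measure is again strongly Rayleigh, so that strongly Rayleigh measures
> belong to the class PHR. **Theorem 4.2.** If `μ ∈ 𝔓_n` is strongly Rayleigh then so is its symmetric
> homogenization `μ_sh ∈ 𝔓_{2n}`.
>
> (§4.2, after the proof of Thm. 4.9) Note that since the Rayleigh/h-NLC+ property is also closed under
> conditioning, projections, and external fields, Theorem 4.8 and slight modifications of the above arguments
> [the proof of Thm. 4.9: the class `𝒮` of measures with a stable homogeneous generating polynomial is closed
> under conditioning and pairwise negatively correlated, hence CNA by Theorem 4.8 (Feder–Mihail); every strongly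
> Rayleigh measure is the projection of a measure in `𝒮`; negative association is closed under projections]
> actually yield the following stronger version of Theorem 4.9.
> **Theorem 4.10.** If `μ ∈ 𝔓_n` is PHR then it is CNA+.
> Since homogeneous Rayleigh polynomials need not be stable, strongly Rayleigh ⇒ PHR strictly.

## Transposition (as in `FederMihail.lean`, `StronglyRayleighNegativeAssociation.lean`)

* Measures are unnormalised weights `μ : Finset σ → ℝ`, `μ ≥ 0`, on `2^σ`; the generating polynomial is the
  tree's `multiAffine μ = Σ_S μ(S) z^S`; `ex μ F = Σ_S μ(S) F(S)`, `mass μ = Σ_S μ(S)`; NA is cross-multiplied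
  `ex μ (FG) · mass μ ≤ ex μ F · ex μ G`; conditioning is `pin I O μ` (ground set kept), external fields are
  `extField a μ`; the Rayleigh inequality is the sign of the tree's Rayleigh difference
  `rayleighDiff i j f = ∂_i f ∂_j f - ∂_i∂_j f · f` (Brändén 2007) on the open orthant, exactly as printed
  (nonnegativity of `μ` is kept as a separate hypothesis, as for `StableOrZero`).
* BBL's conditional measure "`X_e = 1`" lives on `2^{[n] ∖ e}` with generating polynomial `∂_e g_μ`: this is the
  **derivative weight** `derivWeight e μ (T) = μ(T ∪ e)` (`T ∌ e`), `pderiv e (multiAffine μ) = multiAffine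
  (derivWeight e μ)`; the tree's `pinIn e μ` (ground set kept) has generating polynomial `z_e ∂_e g_μ`
  (`eval_multiAffine_pinIn`). Prop. 2.1 (1) is proved for `derivWeight` exactly as printed (the coefficient of
  `z_e²` of a quadratic that is nonnegative for all `z_e > 0` is nonnegative — "letting `z_e → ∞`"), and then
  transferred to `pinIn` (the extra factor `z_e` multiplies the Rayleigh differences by `z_e² ≥ 0` or kills them).
* Prop. 2.1 (3) at `α_e = 0` (`pinOut`) needs the Rayleigh inequality at points with a zero coordinate: the
  printed open-orthant condition extends to the closed orthant by continuity (`IsRayleigh.eval_rayleighDiff_nonneg`).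
* "Projection" (BBL §2.1 (ii): `g_μ|_{z_i = 1, i ∉ S}`) of a weight on `2^{σ ⊔ τ}` onto `2^σ` is
  `projLeft ν (S) = Σ_T ν(S ⊔ T)`; **PHR** (Def. 2.6) is `IsPHR μ`: `μ = projLeft ν` for some nonnegative
  homogeneous Rayleigh weight `ν` on `2^{σ ⊔ τ}`, `τ` an auxiliary finite type.
* Proof of Theorem 4.10 as indicated in the source ("slight modifications" of the proof of Thm. 4.9): a
  nonnegative homogeneous Rayleigh weight is pairwise negatively correlated (the Rayleigh inequality at
  `x = (1,…,1)`, `i ≠ j`) and stays so under every conditioning (Prop. 2.1 (1), (3)), i.e. lies in the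
  Feder–Mihail class `IsFederMihail` of Theorem 4.8 (`federMihail_negAssoc`, tree) — hence NA; NA passes to
  the projection (`ex_projLeft`); and PHR is closed under conditioning and external fields because both commute
  with `projLeft` and preserve "nonnegative homogeneous Rayleigh" upstairs (Prop. 2.1 (3), (1), (4)), and under
  projections (re-associate the hidden coordinates, `isPHR_projLeft`).
* "Strongly Rayleigh measures belong to the class PHR": `StableOrZero.isRayleigh` (Thm. 4.1, tree
  `rayleighDiff_nonneg_of_isRealStable` = Brändén's theorem) and `StableOrZero.isPHR` (via Thm. 4.2, tree
  `stableOrZero_symmHomog`), so that the tree's Theorem 4.9 (`StableOrZero.negAssoc_pin_extField`) is recovered from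
  Theorem 4.10.

## Contents (namespace `Literature.Probability.NegativeDependence`)

* §1 `derivWeight` and its algebra with `pinIn`/`pinOut`/`extField`; `pderiv_multiAffine_eq`,
  `eval_multiAffine_pinIn`, `eval_update_multiAffine` (`f = z_e ∂_e f + f|_{z_e=0}`), `mass_derivWeight`.
* §2 `IsRayleigh` (Def. 2.5), `eval_rayleighDiff_multiAffine`, `isRayleigh_iff`, the closed orthant,
  `StableOrZero.isRayleigh` (Thm. 4.1 ⇒ "strongly Rayleigh ⇒ Rayleigh").
* §3 Prop. 2.1: `isRayleigh_derivWeight` (1), `isRayleigh_pinOut` (3), `isRayleigh_pinIn`, `isRayleigh_pin`,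
  `isRayleigh_extField` (4) (flat names: inside a declaration `IsRayleigh.foo` the operations `derivWeight`, `pin`, …
  would resolve to the `IsRayleigh` namespace).
* §4 `IsRayleigh.isPairwiseNC`, `IsRayleigh.isFederMihail`, `IsRayleigh.negAssoc_of_isHomogeneous` (homogeneous
  Rayleigh ⇒ CNA, via Thm. 4.8).
* §5 `projLeft`, `IsPHR` (Def. 2.6), `isPHR_of_isHomogeneous`, `StableOrZero.isPHR`; **Theorem 4.10**:
  `IsPHR.negAssoc` (NA), `isPHR_pin`, `isPHR_extField`, `isPHR_projLeft` (PHR is closed under conditioning,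
  external fields and projections), `IsPHR.negAssoc_pin_extField` / `IsPHR.negAssoc_projLeft_pin_extField` (CNA+),
  `IsPHR.negAssoc_of_mass_eq_one`, `IsPHR.negAssoc_events`, and Thm. 4.9 recovered
  (`StableOrZero.negAssoc_pin_extField_of_isPHR`).

## References

* [BorceaBrandenLiggett2007] J. Borcea, P. Brändén, T. M. Liggett, Negative dependence and the geometry of
  polynomials, J. Amer. Math. Soc. 22 (2009), 521–567; arXiv:0707.2340 — §2.1 Def. 2.5, Prop. 2.1, Def. 2.6,
  Def. 2.7, Remark 2.4; §4 Thm. 4.1, Thm. 4.2; §4.2 Thm. 4.8, Thm. 4.9, Thm. 4.10.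
* [Branden2007] P. Brändén, Polynomials with the half-plane property and matroid theory, Adv. Math. 216 (2007),
  302–320 (Thm. 4.1 above; tree `rayleighDiff_nonneg_of_isRealStable`).
* [Wagner2008] D. G. Wagner, Negatively correlated random variables and Mason's conjecture for independent
  sets in matroids, Ann. Comb. 12 (2008) 211–239 (the origin of Rayleigh polynomials, BBL's [W]).
-/

noncomputable section

open Finset MvPolynomial
open Literature.Combinatorics.Sahi2008
open Literature.Combinatorics.StablePolynomials

namespace Literature.Probability.NegativeDependence

universe u

variable {σ : Type u} [Fintype σ] [DecidableEq σ]

/-! ## §1 The derivative weight (`X_e = 1`: generating polynomial `∂_e g_μ`) -/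

section DerivWeight

/-- **Derivative weight** (BBL's conditioning on `X_e = 1`, §2.1 (iii): the measure on `2^{[n] ∖ e}` with
generating polynomial `∂_e g_μ`): `T ↦ μ(T ∪ e)` for `T ∌ e`, `0` on sets containing `e`.
[cite: BorceaBrandenLiggett2007, §2.1 (iii) (conditioning `X_i = 1`: `∂_i g_μ`)] -/
def derivWeight (e : σ) (μ : Finset σ → ℝ) : Finset σ → ℝ := fun T => if e ∈ T then 0 else μ (insert e T)

omit [Fintype σ] in
/-- Unfolding `derivWeight`. [cite: BorceaBrandenLiggett2007, §2.1 (iii)] -/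
theorem derivWeight_apply (e : σ) (μ : Finset σ → ℝ) (T : Finset σ) :
    derivWeight e μ T = if e ∈ T then 0 else μ (insert e T) := rfl

omit [Fintype σ] in
/-- The derivative weight vanishes on sets containing `e`. [cite: BorceaBrandenLiggett2007, §2.1 (iii)] -/
theorem derivWeight_of_mem {e : σ} (μ : Finset σ → ℝ) {T : Finset σ} (h : e ∈ T) : derivWeight e μ T = 0 := by
  rw [derivWeight_apply, if_pos h]

omit [Fintype σ] in
/-- The derivative weight off `e`. [cite: BorceaBrandenLiggett2007, §2.1 (iii)] -/
theorem derivWeight_of_not_mem {e : σ} (μ : Finset σ → ℝ) {T : Finset σ} (h : e ∉ T) :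
    derivWeight e μ T = μ (insert e T) := by
  rw [derivWeight_apply, if_neg h]

omit [Fintype σ] in
/-- Derivative weights of nonnegative weights are nonnegative. [cite: BorceaBrandenLiggett2007, §2.1 (iii)] -/
theorem derivWeight_nonneg {μ : Finset σ → ℝ} (h0 : ∀ S, 0 ≤ μ S) (e : σ) (T : Finset σ) : 0 ≤ derivWeight e μ T := by
  rw [derivWeight_apply]
  split_ifs
  · exact le_rfl
  · exact h0 _

omit [Fintype σ] in
/-- `derivWeight e 0 = 0`. [cite: BorceaBrandenLiggett2007, §2.1 (iii)] -/
@[simp] theorem derivWeight_zero (e : σ) : derivWeight e (0 : Finset σ → ℝ) = 0 := by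
  funext T
  simp [derivWeight_apply]

omit [Fintype σ] in
/-- `∂_e ∂_e g_μ = 0` (multi-affinity): the second derivative weight in the same coordinate vanishes.
[cite: BorceaBrandenLiggett2007, §2.1 (multi-affine generating polynomials)] -/
@[simp] theorem derivWeight_derivWeight_self (e : σ) (μ : Finset σ → ℝ) : derivWeight e (derivWeight e μ) = 0 := by
  funext T
  simp only [derivWeight_apply, Pi.zero_apply, Finset.mem_insert_self, if_true]
  split_ifs <;> rfl

omit [Fintype σ] in
/-- `∂_i ∂_j = ∂_j ∂_i` on weights. [cite: BorceaBrandenLiggett2007, §2.1 (iii)] -/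
theorem derivWeight_comm (i j : σ) (μ : Finset σ → ℝ) :
    derivWeight i (derivWeight j μ) = derivWeight j (derivWeight i μ) := by
  funext T
  simp only [derivWeight_apply, Finset.mem_insert]
  by_cases hij : i = j
  · subst hij
    simp
  · by_cases hi : i ∈ T <;> by_cases hj : j ∈ T <;> simp [hi, hj, hij, Ne.symm hij, Finset.insert_comm]

omit [Fintype σ] in
/-- Scalars pass through `derivWeight`. [cite: BorceaBrandenLiggett2007, §2.1 (iii)] -/
theorem derivWeight_smul (c : ℝ) (e : σ) (μ : Finset σ → ℝ) : derivWeight e (c • μ) = c • derivWeight e μ := by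
  funext T
  simp only [derivWeight_apply, Pi.smul_apply, smul_eq_mul]
  split_ifs <;> simp

omit [Fintype σ] in
/-- `∂_i` commutes with the deletion `z_e := 0` for `i ≠ e`. [cite: BorceaBrandenLiggett2007, §2.1 (iii)] -/
theorem derivWeight_pinOut_of_ne {i e : σ} (h : i ≠ e) (μ : Finset σ → ℝ) :
    derivWeight i (pinOut e μ) = pinOut e (derivWeight i μ) := by
  funext T
  simp only [derivWeight_apply, pinOut_apply, Finset.mem_insert, Ne.symm h, false_or]
  split_ifs <;> rfl

omit [Fintype σ] in
/-- `∂_e (g|_{z_e = 0}) = 0`. [cite: BorceaBrandenLiggett2007, §2.1 (iii)] -/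
@[simp] theorem derivWeight_pinOut_self (e : σ) (μ : Finset σ → ℝ) : derivWeight e (pinOut e μ) = 0 := by
  funext T
  simp only [derivWeight_apply, pinOut_apply, Finset.mem_insert_self, if_true, Pi.zero_apply]
  split_ifs <;> rfl

omit [Fintype σ] in
/-- `∂_i` commutes with the conditioning on `e ∈ S` for `i ≠ e`. [cite: BorceaBrandenLiggett2007, §2.1 (iii)] -/
theorem derivWeight_pinIn_of_ne {i e : σ} (h : i ≠ e) (μ : Finset σ → ℝ) :
    derivWeight i (pinIn e μ) = pinIn e (derivWeight i μ) := by
  funext T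
  simp only [derivWeight_apply, pinIn_apply, Finset.mem_insert, Ne.symm h, false_or]
  split_ifs <;> rfl

omit [Fintype σ] in
/-- `∂_e (z_e ∂_e g) = ∂_e g` on weights. [cite: BorceaBrandenLiggett2007, §2.1 (iii)] -/
@[simp] theorem derivWeight_pinIn_self (e : σ) (μ : Finset σ → ℝ) : derivWeight e (pinIn e μ) = derivWeight e μ := by
  funext T
  simp only [derivWeight_apply, pinIn_apply, Finset.mem_insert_self, if_true]

omit [Fintype σ] in
/-- `∂_e` of an external field: `∂_e (g(a z)) = a_e (∂_e g)(a z)`. [cite: BorceaBrandenLiggett2007, §2.1 (iii), (iv)] -/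
theorem derivWeight_extField (a : σ → ℝ) (e : σ) (μ : Finset σ → ℝ) :
    derivWeight e (extField a μ) = a e • extField a (derivWeight e μ) := by
  funext T
  simp only [derivWeight_apply, extField_apply, Pi.smul_apply, smul_eq_mul]
  split_ifs with h
  · simp
  · rw [Finset.prod_insert h]
    ring

omit [DecidableEq σ] in
/-- `multiAffine` is additive in the weight. [folklore] -/
private theorem multiAffine_add' (μ ν : Finset σ → ℝ) : multiAffine (μ + ν) = multiAffine μ + multiAffine ν := by
  simp only [multiAffine, Pi.add_apply, map_add, add_mul, Finset.sum_add_distrib]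

omit [DecidableEq σ] in
/-- The zero weight has zero generating polynomial. [folklore] -/
private theorem multiAffine_zero_weight : multiAffine (0 : Finset σ → ℝ) = 0 := by
  simp [multiAffine]

omit [DecidableEq σ] in
/-- `eval x (multiAffine (c • μ)) = c · eval x (multiAffine μ)`. [folklore] -/
private theorem eval_multiAffine_smul (c : ℝ) (μ : Finset σ → ℝ) (x : σ → ℝ) :
    MvPolynomial.eval x (multiAffine (c • μ)) = c * MvPolynomial.eval x (multiAffine μ) := by
  simp only [eval_multiAffine, Pi.smul_apply, smul_eq_mul, Finset.mul_sum, mul_assoc]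

/-- **`∂_i (Σ_S μ(S) z^S) = Σ_T μ(T ∪ i) z^T`** (real coefficients; the tree's `pderiv_multiAffine` over `ℂ`).
[cite: BorceaBrandenLiggett2007, §2.1 (iii) ("`∂_i g_μ`")] -/
theorem pderiv_multiAffine_eq (μ : Finset σ → ℝ) (i : σ) :
    MvPolynomial.pderiv i (multiAffine μ) = multiAffine (derivWeight i μ) := by
  apply MvPolynomial.map_injective (algebraMap ℝ ℂ) (RingHom.injective _)
  rw [← pderiv_map, map_multiAffine, map_multiAffine, pderiv_multiAffine]
  congr 1
  funext T
  simp only [Function.comp_apply, derivWeight_apply]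
  split_ifs <;> simp

/-- **`g_{μ | e ∈ S}(x) = x_e · (∂_e g_μ)(x)`**: the generating polynomial of `pinIn e μ` is `z_e ∂_e g_μ`.
[cite: BorceaBrandenLiggett2007, §2.1 (iii) (conditioning on `X_e = 1`)] -/
theorem eval_multiAffine_pinIn (μ : Finset σ → ℝ) (e : σ) (x : σ → ℝ) :
    MvPolynomial.eval x (multiAffine (pinIn e μ)) = x e * MvPolynomial.eval x (multiAffine (derivWeight e μ)) := by
  have h : (∑ S : Finset σ, ((pinIn e μ S : ℝ) : ℂ) * ∏ i ∈ S, (x i : ℂ)) =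
      (x e : ℂ) * ∑ T : Finset σ, ((derivWeight e μ T : ℝ) : ℂ) * ∏ i ∈ T, (x i : ℂ) :=
    sum_pinIn_mul_prod μ e fun k => (x k : ℂ)
  rw [eval_multiAffine, eval_multiAffine]
  exact_mod_cast h

omit [DecidableEq σ] in
/-- A weight vanishing on the sets containing `e` has a generating polynomial independent of `z_e` (both `∂_e g_μ`
and `g_μ|_{z_e = 0}` are such). [cite: BorceaBrandenLiggett2007, §2.1 proof of Prop. 2.1 (1) (`f = z_i ∂_i f +
f|_{z_i = 0}`)] -/
theorem eval_update_multiAffine_of_forall_mem [DecidableEq σ] {μ : Finset σ → ℝ} {e : σ}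
    (hμ : ∀ S, e ∈ S → μ S = 0) (x : σ → ℝ) (t : ℝ) :
    MvPolynomial.eval (Function.update x e t) (multiAffine μ) = MvPolynomial.eval x (multiAffine μ) := by
  rw [eval_multiAffine, eval_multiAffine]
  refine Finset.sum_congr rfl fun S _ => ?_
  by_cases heS : e ∈ S
  · rw [hμ S heS, zero_mul, zero_mul]
  · congr 1
    exact Finset.prod_congr rfl fun i hi => by rw [Function.update_of_ne (ne_of_mem_of_not_mem hi heS)]

/-- **`g|_{z_e = 0}` is the generating polynomial of `pinOut e μ`.** [cite: BorceaBrandenLiggett2007, §2.1 (iii)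
(conditioning on `X_e = 0`: `g_μ|_{z_e = 0}`)] -/
theorem eval_multiAffine_pinOut (μ : Finset σ → ℝ) (e : σ) (x : σ → ℝ) :
    MvPolynomial.eval x (multiAffine (pinOut e μ)) = MvPolynomial.eval (Function.update x e 0) (multiAffine μ) := by
  rw [eval_multiAffine, eval_multiAffine]
  refine Finset.sum_congr rfl fun S _ => ?_
  rw [pinOut_apply]
  by_cases heS : e ∈ S
  · rw [if_pos heS, zero_mul, Finset.prod_eq_zero heS (by simp), mul_zero]
  · rw [if_neg heS]
    congr 1
    exact Finset.prod_congr rfl fun i hi => by rw [Function.update_of_ne (ne_of_mem_of_not_mem hi heS)]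

/-- **`f = z_e ∂_e f + f|_{z_e = 0}`** for the multi-affine `f = g_μ`, evaluated at `x` with `x_e := t`:
`g_μ(x; z_e = t) = t · (∂_e g_μ)(x) + g_μ|_{z_e=0}(x)`. [cite: BorceaBrandenLiggett2007, §2.1 proof of Prop. 2.1
(1) ("first writing `f = z_i ∂_i f + f|_{z_i = 0}`")] -/
theorem eval_update_multiAffine (μ : Finset σ → ℝ) (e : σ) (x : σ → ℝ) (t : ℝ) :
    MvPolynomial.eval (Function.update x e t) (multiAffine μ) =
      t * MvPolynomial.eval x (multiAffine (derivWeight e μ)) + MvPolynomial.eval x (multiAffine (pinOut e μ)) := by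
  have hsplit : multiAffine μ = multiAffine (pinIn e μ) + multiAffine (pinOut e μ) := by
    rw [← multiAffine_add']
    congr 1
    funext S
    rw [Pi.add_apply, pinIn_add_pinOut]
  rw [hsplit, map_add, eval_multiAffine_pinIn, Function.update_self,
    eval_update_multiAffine_of_forall_mem (fun S hS => derivWeight_of_mem μ hS),
    eval_update_multiAffine_of_forall_mem (fun S hS => by rw [pinOut_apply, if_pos hS])]

/-- The generating polynomial at `x` splits along `e`: `g_μ(x) = x_e (∂_e g_μ)(x) + g_μ|_{z_e=0}(x)`.
[cite: BorceaBrandenLiggett2007, §2.1 proof of Prop. 2.1 (1)] -/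
theorem eval_multiAffine_split (μ : Finset σ → ℝ) (e : σ) (x : σ → ℝ) :
    MvPolynomial.eval x (multiAffine μ) =
      x e * MvPolynomial.eval x (multiAffine (derivWeight e μ)) + MvPolynomial.eval x (multiAffine (pinOut e μ)) := by
  rw [← eval_update_multiAffine, Function.update_eq_self]

omit [DecidableEq σ] in
/-- **External fields are the substitution `z_i ↦ a_i z_i`**: `g_{μ^a}(x) = g_μ(a x)`.
[cite: BorceaBrandenLiggett2007, §2.1 (iv) (external fields)] -/
theorem eval_multiAffine_extField (a : σ → ℝ) (μ : Finset σ → ℝ) (x : σ → ℝ) :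
    MvPolynomial.eval x (multiAffine (extField a μ)) = MvPolynomial.eval (fun i => a i * x i) (multiAffine μ) := by
  rw [eval_multiAffine, eval_multiAffine]
  refine Finset.sum_congr rfl fun S _ => ?_
  rw [extField_apply, Finset.prod_mul_distrib]
  ring

omit [DecidableEq σ] in
/-- At the all-ones point the generating polynomial is the total mass. [cite: BorceaBrandenLiggett2007, §2.1
("`g_μ(1,…,1)`")] -/
theorem eval_one_multiAffine (μ : Finset σ → ℝ) : MvPolynomial.eval (fun _ => (1 : ℝ)) (multiAffine μ) = mass μ := by
  simp [eval_multiAffine, mass]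

/-- `μ(X_e = 1) = (∂_e g_μ)(1,…,1)`: the derivative weight has the mass of `pinIn e μ`.
[cite: BorceaBrandenLiggett2007, §2.1 (iii) ("`∂_i g_μ(1,…,1)`")] -/
theorem mass_derivWeight (e : σ) (μ : Finset σ → ℝ) : mass (derivWeight e μ) = mass (pinIn e μ) := by
  rw [← eval_one_multiAffine, ← eval_one_multiAffine, eval_multiAffine_pinIn, one_mul]

end DerivWeight

/-! ## §2 Rayleigh weights (Def. 2.5) -/

section Rayleigh

omit [DecidableEq σ] in
/-- **Rayleigh weight** (BBL Def. 2.5 for the generating polynomial `g_μ = Σ_S μ(S) z^S`):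
`∂_i g_μ(x) ∂_j g_μ(x) ≥ ∂_i∂_j g_μ(x) g_μ(x)` for all `x ∈ (0,∞)^σ` and all `i, j` — the tree's Rayleigh
difference `Δ_{ij}(g_μ) = ∂_i g_μ ∂_j g_μ - ∂_i∂_j g_μ · g_μ` is nonnegative on the open orthant. A *Rayleigh
measure* is a nonnegative (probability) weight with this property. [cite: BorceaBrandenLiggett2007, §2.1 Def. 2.5] -/
def IsRayleigh (μ : Finset σ → ℝ) : Prop :=
  ∀ x : σ → ℝ, (∀ k, 0 < x k) → ∀ i j : σ, 0 ≤ MvPolynomial.eval x (rayleighDiff i j (multiAffine μ))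

omit [DecidableEq σ] in
/-- Unfolding Def. 2.5. [cite: BorceaBrandenLiggett2007, §2.1 Def. 2.5] -/
theorem isRayleigh_def (μ : Finset σ → ℝ) :
    IsRayleigh μ ↔
      ∀ x : σ → ℝ, (∀ k, 0 < x k) → ∀ i j : σ, 0 ≤ MvPolynomial.eval x (rayleighDiff i j (multiAffine μ)) :=
  Iff.rfl

/-- **The Rayleigh difference of a generating polynomial in terms of derivative weights**:
`Δ_{ij}(g_μ)(x) = g_{∂_iμ}(x) g_{∂_jμ}(x) - g_{∂_i∂_jμ}(x) g_μ(x)`. [cite: BorceaBrandenLiggett2007, §2.1 Def. 2.5] -/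
theorem eval_rayleighDiff_multiAffine (μ : Finset σ → ℝ) (i j : σ) (x : σ → ℝ) :
    MvPolynomial.eval x (rayleighDiff i j (multiAffine μ)) =
      MvPolynomial.eval x (multiAffine (derivWeight i μ)) * MvPolynomial.eval x (multiAffine (derivWeight j μ)) -
        MvPolynomial.eval x (multiAffine (derivWeight i (derivWeight j μ))) * MvPolynomial.eval x (multiAffine μ) := by
  simp only [rayleighDiff, pderiv_multiAffine_eq, map_sub, map_mul]

/-- Def. 2.5 in weight form: `g_{∂_i∂_jμ}(x) g_μ(x) ≤ g_{∂_iμ}(x) g_{∂_jμ}(x)` on the open orthant.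
[cite: BorceaBrandenLiggett2007, §2.1 Def. 2.5] -/
theorem isRayleigh_iff (μ : Finset σ → ℝ) :
    IsRayleigh μ ↔ ∀ x : σ → ℝ, (∀ k, 0 < x k) → ∀ i j : σ,
      MvPolynomial.eval x (multiAffine (derivWeight i (derivWeight j μ))) * MvPolynomial.eval x (multiAffine μ) ≤
        MvPolynomial.eval x (multiAffine (derivWeight i μ)) * MvPolynomial.eval x (multiAffine (derivWeight j μ)) := by
  simp only [IsRayleigh, eval_rayleighDiff_multiAffine, sub_nonneg]

/-- The Rayleigh inequality at a point of the open orthant. [cite: BorceaBrandenLiggett2007, §2.1 Def. 2.5] -/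
theorem IsRayleigh.le {μ : Finset σ → ℝ} (h : IsRayleigh μ) {x : σ → ℝ} (hx : ∀ k, 0 < x k) (i j : σ) :
    MvPolynomial.eval x (multiAffine (derivWeight i (derivWeight j μ))) * MvPolynomial.eval x (multiAffine μ) ≤
      MvPolynomial.eval x (multiAffine (derivWeight i μ)) * MvPolynomial.eval x (multiAffine (derivWeight j μ)) :=
  (isRayleigh_iff μ).1 h x hx i j

omit [DecidableEq σ] in
/-- **The Rayleigh inequalities extend to the closed orthant** `[0,∞)^σ` (continuity along `x + ε𝟙`, `ε → 0⁺`).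
[cite: BorceaBrandenLiggett2007, §2.1 Prop. 2.1 (3) (`α_i ≥ 0`, in particular `z_i = 0`)] -/
theorem IsRayleigh.eval_rayleighDiff_nonneg {μ : Finset σ → ℝ} (h : IsRayleigh μ) {x : σ → ℝ} (hx : ∀ k, 0 ≤ x k)
    (i j : σ) : 0 ≤ MvPolynomial.eval x (rayleighDiff i j (multiAffine μ)) := by
  set P := rayleighDiff i j (multiAffine μ) with hP
  let L : ℝ → ℝ := fun ε => MvPolynomial.eval (fun k => x k + ε) P
  have hpath : Continuous fun ε : ℝ => (fun k : σ => x k + ε) := continuous_pi fun k => continuous_const.add continuous_id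
  have hL : Continuous L := (MvPolynomial.continuous_eval P).comp hpath
  have hev : ∀ᶠ ε in nhdsWithin (0 : ℝ) (Set.Ioi 0), 0 ≤ L ε :=
    eventually_nhdsWithin_of_forall fun ε (hε : 0 < ε) => h _ (fun k => by linarith [hx k]) i j
  have hLt : Filter.Tendsto L (nhdsWithin 0 (Set.Ioi 0)) (nhds (L 0)) := (hL.tendsto 0).mono_left nhdsWithin_le_nhds
  have key : 0 ≤ L 0 := ge_of_tendsto hLt hev
  simpa [L] using key

/-- The closed-orthant Rayleigh inequality in weight form. [cite: BorceaBrandenLiggett2007, §2.1 Def. 2.5,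
Prop. 2.1 (3)] -/
theorem IsRayleigh.le_of_nonneg {μ : Finset σ → ℝ} (h : IsRayleigh μ) {x : σ → ℝ} (hx : ∀ k, 0 ≤ x k) (i j : σ) :
    MvPolynomial.eval x (multiAffine (derivWeight i (derivWeight j μ))) * MvPolynomial.eval x (multiAffine μ) ≤
      MvPolynomial.eval x (multiAffine (derivWeight i μ)) * MvPolynomial.eval x (multiAffine (derivWeight j μ)) := by
  rw [← sub_nonneg, ← eval_rayleighDiff_multiAffine]
  exact h.eval_rayleighDiff_nonneg hx i j

omit [DecidableEq σ] in
/-- A weight is Rayleigh as soon as its Rayleigh differences are nonnegative on the closed orthant.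
[cite: BorceaBrandenLiggett2007, §2.1 Def. 2.5] -/
theorem isRayleigh_of_forall_nonneg {μ : Finset σ → ℝ}
    (h : ∀ x : σ → ℝ, (∀ k, 0 ≤ x k) → ∀ i j : σ, 0 ≤ MvPolynomial.eval x (rayleighDiff i j (multiAffine μ))) :
    IsRayleigh μ :=
  fun x hx i j => h x (fun k => (hx k).le) i j

omit [DecidableEq σ] in
/-- The zero weight is Rayleigh. [cite: BorceaBrandenLiggett2007, §2.1 Def. 2.5] -/
theorem isRayleigh_zero : IsRayleigh (0 : Finset σ → ℝ) := by
  intro x _ i j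
  have : multiAffine (0 : Finset σ → ℝ) = 0 := by simp [multiAffine]
  simp [rayleighDiff, this]

omit [DecidableEq σ] in
/-- The real coefficient form is multi-affine. [folklore] -/
private theorem isMultiAffine_multiAffine_of_real (μ : Finset σ → ℝ) : IsMultiAffine (multiAffine μ) := by
  have h := isMultiAffine_multiAffine (fun S => (algebraMap ℝ ℂ) (μ S))
  rw [isMultiAffine_iff_support] at h ⊢
  intro m hm i
  refine h m ?_ i
  rw [show (multiAffine fun S => (algebraMap ℝ ℂ) (μ S)) = MvPolynomial.map (algebraMap ℝ ℂ) (multiAffine μ) by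
    rw [map_multiAffine]; rfl, support_map_of_injective _ (RingHom.injective _)]
  exact hm

/-- **"A strongly Rayleigh measure is automatically Rayleigh"** (BBL after Thm. 4.1 = Brändén's theorem: a real
stable multi-affine polynomial satisfies the Rayleigh inequalities at every real point; tree
`rayleighDiff_nonneg_of_isRealStable`). Stated for the tree's "stable or zero" weights.
[cite: BorceaBrandenLiggett2007, §4 Thm. 4.1 and the sentence following it; Branden2007, §5 Thm. 5.6] -/
theorem StableOrZero.isRayleigh {μ : Finset σ → ℝ} (h : StableOrZero μ) : IsRayleigh μ := by
  rcases (stableOrZero_iff μ).1 h with h0 | hst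
  · intro x _ i j
    simp [rayleighDiff, h0]
  · exact fun x _ i j => rayleighDiff_nonneg_of_isRealStable (isMultiAffine_multiAffine_of_real μ) hst x i j

end Rayleigh

/-! ## §3 Proposition 2.1: derivatives, specialisations and external fields of Rayleigh weights -/

section Operations

/-- "Letting `z_e → ∞`": if `α t² + β t + γ ≥ 0` for all `t > 0` then `α ≥ 0`. [cite: BorceaBrandenLiggett2007,
§2.1 proof of Prop. 2.1 (1)] -/
theorem nonneg_of_forall_pos_quadratic_nonneg {α β γ : ℝ} (h : ∀ t : ℝ, 0 < t → 0 ≤ α * t ^ 2 + β * t + γ) :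
    0 ≤ α := by
  by_contra hα
  push Not at hα
  set t : ℝ := (|β| + |γ| + 1) / (-α) + 1 with ht
  have hα' : 0 < -α := by linarith
  have ht1 : 1 ≤ t := by
    have : 0 ≤ (|β| + |γ| + 1) / (-α) := div_nonneg (by positivity) hα'.le
    linarith
  have ht0 : 0 < t := by linarith
  have hα0 : α ≠ 0 := hα.ne
  have hmul : α * ((|β| + |γ| + 1) / (-α)) = -(|β| + |γ| + 1) := by
    rw [← mul_div_assoc, div_neg, mul_div_cancel_left₀ _ hα0]
  have hlin : α * t + |β| + |γ| = α - 1 := by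
    rw [ht, mul_add, hmul, mul_one]
    ring
  have key := h t ht0
  have hβ : β * t ≤ |β| * t := mul_le_mul_of_nonneg_right (le_abs_self β) ht0.le
  have hγ : γ ≤ |γ| * t := (le_abs_self γ).trans (le_mul_of_one_le_right (abs_nonneg γ) ht1)
  have : α * t ^ 2 + β * t + γ ≤ t * (α * t + |β| + |γ|) := by nlinarith
  rw [hlin] at this
  nlinarith

/-- **Prop. 2.1 (1): `∂_e f` is Rayleigh when `f` is** (the coefficient of `z_e²` in the Rayleigh inequality
`Δ_{ij}(f)(x) ≥ 0`, a quadratic in `x_e > 0`, is `Δ_{ij}(∂_e f)(x)`). [cite: BorceaBrandenLiggett2007, §2.1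
Prop. 2.1 (1) and its proof] -/
theorem isRayleigh_derivWeight {μ : Finset σ → ℝ} (h : IsRayleigh μ) (e : σ) : IsRayleigh (derivWeight e μ) := by
  rw [isRayleigh_iff] at h ⊢
  intro x hx i j
  -- the Rayleigh inequality for `μ` at `x` with `x_e := t`, expanded in `t`
  have key : ∀ t : ℝ, 0 < t →
      0 ≤ (MvPolynomial.eval x (multiAffine (derivWeight i (derivWeight e μ))) *
              MvPolynomial.eval x (multiAffine (derivWeight j (derivWeight e μ))) -
            MvPolynomial.eval x (multiAffine (derivWeight i (derivWeight j (derivWeight e μ)))) *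
              MvPolynomial.eval x (multiAffine (derivWeight e μ))) * t ^ 2 +
          (MvPolynomial.eval x (multiAffine (derivWeight i (derivWeight e μ))) *
                MvPolynomial.eval x (multiAffine (pinOut e (derivWeight j μ))) +
              MvPolynomial.eval x (multiAffine (pinOut e (derivWeight i μ))) *
                MvPolynomial.eval x (multiAffine (derivWeight j (derivWeight e μ))) -
            (MvPolynomial.eval x (multiAffine (derivWeight i (derivWeight j (derivWeight e μ)))) *
                MvPolynomial.eval x (multiAffine (pinOut e μ)) +
              MvPolynomial.eval x (multiAffine (pinOut e (derivWeight i (derivWeight j μ)))) *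
                MvPolynomial.eval x (multiAffine (derivWeight e μ)))) * t +
          (MvPolynomial.eval x (multiAffine (pinOut e (derivWeight i μ))) *
              MvPolynomial.eval x (multiAffine (pinOut e (derivWeight j μ))) -
            MvPolynomial.eval x (multiAffine (pinOut e (derivWeight i (derivWeight j μ)))) *
              MvPolynomial.eval x (multiAffine (pinOut e μ))) := by
    intro t ht
    have hxt : ∀ k, 0 < Function.update x e t k := fun k => by
      rcases eq_or_ne k e with rfl | hk
      · rwa [Function.update_self]
      · rw [Function.update_of_ne hk]; exact hx k
    have hR := sub_nonneg.2 (h (Function.update x e t) hxt i j)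
    rw [eval_update_multiAffine, eval_update_multiAffine, eval_update_multiAffine, eval_update_multiAffine,
      derivWeight_comm e i, derivWeight_comm e j, derivWeight_comm e i (derivWeight j μ),
      derivWeight_comm e j μ] at hR
    convert hR using 1
    ring
  exact sub_nonneg.1 (nonneg_of_forall_pos_quadratic_nonneg key)

/-- **Prop. 2.1 (3) at `α_e = 0`: `f|_{z_e = 0}` is Rayleigh when `f` is** — conditioning on `e ∉ S`.
[cite: BorceaBrandenLiggett2007, §2.1 Prop. 2.1 (3)] -/
theorem isRayleigh_pinOut {μ : Finset σ → ℝ} (h : IsRayleigh μ) (e : σ) : IsRayleigh (pinOut e μ) := by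
  rw [isRayleigh_iff]
  intro x hx i j
  have hx0 : ∀ k, 0 ≤ Function.update x e 0 k := fun k => by
    rcases eq_or_ne k e with rfl | hk
    · rw [Function.update_self]
    · rw [Function.update_of_ne hk]; exact (hx k).le
  rcases eq_or_ne i e with rfl | hie
  · rw [derivWeight_comm i j (pinOut i μ), derivWeight_pinOut_self, derivWeight_zero]
    simp [multiAffine_zero_weight]
  rcases eq_or_ne j e with rfl | hje
  · rw [derivWeight_pinOut_self, derivWeight_zero]
    simp [multiAffine_zero_weight]
  rw [derivWeight_pinOut_of_ne hje, derivWeight_pinOut_of_ne hie, derivWeight_pinOut_of_ne hie,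
    eval_multiAffine_pinOut, eval_multiAffine_pinOut, eval_multiAffine_pinOut, eval_multiAffine_pinOut]
  exact h.le_of_nonneg hx0 i j

/-- **Conditioning on `e ∈ S` keeps the Rayleigh property** (`z_e ∂_e f` is Rayleigh when `f` is: Prop. 2.1 (1)
and the factor `z_e`). [cite: BorceaBrandenLiggett2007, §2.1 Prop. 2.1 (1); §4.2 ("the Rayleigh/h-NLC+ property
is also closed under conditioning")] -/
theorem isRayleigh_pinIn {μ : Finset σ → ℝ} (h : IsRayleigh μ) (e : σ) : IsRayleigh (pinIn e μ) := by
  have hd := (isRayleigh_iff _).1 (isRayleigh_derivWeight h e)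
  rw [isRayleigh_iff]
  intro x hx i j
  rcases eq_or_ne i e with rfl | hie
  · rcases eq_or_ne j i with rfl | hji
    · simp only [derivWeight_pinIn_self, derivWeight_derivWeight_self]
      rw [multiAffine_zero_weight, map_zero, zero_mul]
      exact mul_self_nonneg _
    · rw [derivWeight_pinIn_of_ne hji, derivWeight_pinIn_self, derivWeight_pinIn_self, eval_multiAffine_pinIn,
        eval_multiAffine_pinIn]
      exact le_of_eq (by ring)
  rcases eq_or_ne j e with rfl | hje
  · rw [derivWeight_pinIn_self, derivWeight_pinIn_of_ne hie, eval_multiAffine_pinIn, eval_multiAffine_pinIn,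
      derivWeight_comm i j μ]
    exact le_of_eq (by ring)
  rw [derivWeight_pinIn_of_ne hje, derivWeight_pinIn_of_ne hie, derivWeight_pinIn_of_ne hie, eval_multiAffine_pinIn,
    eval_multiAffine_pinIn, eval_multiAffine_pinIn, eval_multiAffine_pinIn, derivWeight_comm e i (derivWeight j μ),
    derivWeight_comm e j μ, derivWeight_comm e i μ]
  have key := hd x hx i j
  have hxe : 0 ≤ x e := (hx e).le
  have h2 := mul_le_mul_of_nonneg_left key (mul_nonneg hxe hxe)
  exact Eq.trans_le (by ring) (h2.trans_eq (by ring))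

/-- **The Rayleigh property is closed under conditioning.** [cite: BorceaBrandenLiggett2007, §2.1 Prop. 2.1
(1), (3); §4.2 (before Thm. 4.10)] -/
theorem isRayleigh_pin {μ : Finset σ → ℝ} (h : IsRayleigh μ) (I O : Finset σ) : IsRayleigh (pin I O μ) := by
  induction I using Finset.induction_on with
  | empty =>
    induction O using Finset.induction_on with
    | empty => rwa [pin_empty_empty]
    | insert e O _ ih => rw [← pinOut_pin]; exact isRayleigh_pinOut ih e
  | insert e I _ ih => rw [← pinIn_pin]; exact isRayleigh_pinIn ih e

omit [DecidableEq σ] in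
/-- **Prop. 2.1 (4): `f(a_1 z_1, …, a_n z_n)` is Rayleigh for `a_i ≥ 0`** — external fields
(`Δ_{ij}(f(az))(x) = a_i a_j Δ_{ij}(f)(ax)`). [cite: BorceaBrandenLiggett2007, §2.1 Prop. 2.1 (4); §4.2 ("closed
under … external fields")] -/
theorem isRayleigh_extField [DecidableEq σ] {μ : Finset σ → ℝ} (h : IsRayleigh μ) {a : σ → ℝ} (ha : ∀ i, 0 ≤ a i) :
    IsRayleigh (extField a μ) := by
  rw [isRayleigh_iff]
  intro x hx i j
  have hax : ∀ k, 0 ≤ a k * x k := fun k => mul_nonneg (ha k) (hx k).le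
  rw [derivWeight_extField, derivWeight_extField, derivWeight_smul, derivWeight_extField, ← mul_smul,
    eval_multiAffine_smul, eval_multiAffine_smul, eval_multiAffine_smul, eval_multiAffine_extField,
    eval_multiAffine_extField, eval_multiAffine_extField, eval_multiAffine_extField]
  have key := h.le_of_nonneg hax i j
  have haij : 0 ≤ a i * a j := mul_nonneg (ha i) (ha j)
  nlinarith [mul_le_mul_of_nonneg_left key haij]

end Operations

/-! ## §4 Homogeneous Rayleigh weights are in the Feder–Mihail class (Thm. 4.8) -/

section FederMihailClass

/-- **A Rayleigh weight is pairwise negatively correlated**: the Rayleigh inequality at `x = (1,…,1)` for `i ≠ j`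
reads `μ(i,j ∈ S) μ(Ω) ≤ μ(i ∈ S) μ(j ∈ S)`. [cite: BorceaBrandenLiggett2007, §2.1 Remark 2.3 ("each of the five
properties … Rayleigh … implies p-NC"); §4.2 proof of Thm. 4.9/4.10] -/
theorem IsRayleigh.isPairwiseNC {μ : Finset σ → ℝ} (h : IsRayleigh μ) : IsPairwiseNC μ := by
  intro x y hxy
  have key := h.le (x := fun _ => (1 : ℝ)) (fun _ => one_pos) x y
  rw [eval_one_multiAffine, eval_one_multiAffine, eval_one_multiAffine, eval_one_multiAffine, mass_derivWeight,
    mass_derivWeight, mass_derivWeight, ← derivWeight_pinIn_of_ne hxy.symm, mass_derivWeight] at key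
  rwa [sum_filter_mem_mem_eq_mass_pinIn_pinIn, sum_filter_mem_eq_mass_pinIn, sum_filter_mem_eq_mass_pinIn, ← mass_def]

/-- **The class of Theorem 4.10**: a nonnegative homogeneous Rayleigh weight satisfies the hypotheses of the
Feder–Mihail theorem (Thm. 4.8) — it is homogeneous and every conditioning is pairwise negatively correlated.
[cite: BorceaBrandenLiggett2007, §4.2 Thm. 4.8 and the paragraph before Thm. 4.10] -/
theorem IsRayleigh.isFederMihail {μ : Finset σ → ℝ} (h : IsRayleigh μ) (h0 : ∀ S, 0 ≤ μ S) (hhom : IsHomogeneous μ) :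
    IsFederMihail μ :=
  ⟨h0, hhom, fun I O => (isRayleigh_pin h I O).isPairwiseNC⟩

/-- **Homogeneous Rayleigh measures are CNA** (Thm. 4.8 applied to the class of nonnegative homogeneous Rayleigh
weights): `E[FG] μ(Ω) ≤ E[F] E[G]` for increasing `F`, `G` depending on disjoint sets of coordinates, for `μ` and
each of its conditionings `pin I O μ`. [cite: BorceaBrandenLiggett2007, §4.2 Thm. 4.8, proof of Thm. 4.10] -/
theorem IsRayleigh.negAssoc_of_isHomogeneous {μ : Finset σ → ℝ} (h : IsRayleigh μ) (h0 : ∀ S, 0 ≤ μ S)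
    (hhom : IsHomogeneous μ) (I O : Finset σ) {F G : Finset σ → ℝ} (hF : Monotone F) (hG : Monotone G)
    {E₁ E₂ : Finset σ} (hFE : DeterminedBy F E₁) (hGE : DeterminedBy G E₂) (hdisj : Disjoint E₁ E₂) :
    ex (pin I O μ) (F * G) * mass (pin I O μ) ≤ ex (pin I O μ) F * ex (pin I O μ) G :=
  federMihail_negAssoc ((h.isFederMihail h0 hhom).pin I O) hF hG hFE hGE hdisj

omit [Fintype σ] [DecidableEq σ] in
/-- External fields keep homogeneity (the support can only shrink). [cite: BorceaBrandenLiggett2007, §2.1 (iv)] -/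
theorem isHomogeneous_extField [Fintype σ] {μ : Finset σ → ℝ} (h : IsHomogeneous μ) (a : σ → ℝ) :
    IsHomogeneous (extField a μ) := by
  obtain ⟨k, hk⟩ := h
  exact ⟨k, fun S hS => hk S (left_ne_zero_of_mul hS)⟩

end FederMihailClass

/-! ## §5 Projections, the class PHR (Def. 2.6) and Theorem 4.10 -/

section PHR

variable {τ : Type u} [Fintype τ] [DecidableEq τ]

omit [Fintype σ] [DecidableEq σ] [DecidableEq τ] in
/-- **Projection** of a weight on `2^{σ ⊔ τ}` onto `2^σ` (BBL §2.1 (ii): `μ'(S) = Σ_{U ∩ σ = S} ν(U)`, generating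
polynomial `g_ν|_{z_t = 1, t ∈ τ}`). [cite: BorceaBrandenLiggett2007, §2.1 (ii) (projections)] -/
def projLeft (ν : Finset (σ ⊕ τ) → ℝ) : Finset σ → ℝ := fun S => ∑ T : Finset τ, ν (S.disjSum T)

omit [Fintype σ] [DecidableEq σ] [DecidableEq τ] in
/-- Unfolding `projLeft`. [cite: BorceaBrandenLiggett2007, §2.1 (ii)] -/
theorem projLeft_apply (ν : Finset (σ ⊕ τ) → ℝ) (S : Finset σ) : projLeft ν S = ∑ T : Finset τ, ν (S.disjSum T) :=
  rfl

omit [Fintype σ] [DecidableEq σ] [DecidableEq τ] in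
/-- Projections of nonnegative weights are nonnegative. [cite: BorceaBrandenLiggett2007, §2.1 (ii)] -/
theorem projLeft_nonneg {ν : Finset (σ ⊕ τ) → ℝ} (h0 : ∀ U, 0 ≤ ν U) (S : Finset σ) : 0 ≤ projLeft ν S :=
  Finset.sum_nonneg fun _ _ => h0 _

omit [DecidableEq σ] [DecidableEq τ] in
/-- Sums over `2^{σ ⊔ τ}` as double sums over pairs `(S, T)`. [folklore] -/
private theorem sum_finset_sum_eq (f : Finset (σ ⊕ τ) → ℝ) :
    ∑ U, f U = ∑ S : Finset σ, ∑ T : Finset τ, f (S.disjSum T) := by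
  rw [← Fintype.sum_prod_type']
  exact Fintype.sum_equiv Finset.sumEquiv.toEquiv _ _ fun U => by
    simp [Finset.sumEquiv, Finset.toLeft_disjSum_toRight]

omit [DecidableEq σ] [DecidableEq τ] in
/-- **Projection of expectations**: `E_{projLeft ν}[H] = E_ν[H ∘ toLeft]` ("negative association is closed under
projections"). [cite: BorceaBrandenLiggett2007, §2.1 (ii); §4.2 proof of Thm. 4.9] -/
theorem ex_projLeft (ν : Finset (σ ⊕ τ) → ℝ) (H : Finset σ → ℝ) :
    ex (projLeft ν) H = ex ν (H ∘ Finset.toLeft) := by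
  rw [ex, ex, sum_finset_sum_eq]
  refine Finset.sum_congr rfl fun S _ => ?_
  simp only [Function.comp_apply, Finset.toLeft_disjSum, projLeft_apply, Finset.sum_mul]

omit [DecidableEq σ] [DecidableEq τ] in
/-- `(projLeft ν)(Ω) = ν(Ω)`. [cite: BorceaBrandenLiggett2007, §2.1 (ii)] -/
theorem mass_projLeft (ν : Finset (σ ⊕ τ) → ℝ) : mass (projLeft ν) = mass ν := by
  have h := ex_projLeft ν (fun _ => 1)
  simp only [ex, Function.comp_apply, mul_one] at h
  rw [mass_def, mass_def]
  exact h

omit [Fintype σ] in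
/-- **Conditioning commutes with projection** (on coordinates of the target). [cite: BorceaBrandenLiggett2007,
§2.1 (ii), (iii); §4.2 ("closed under conditioning, projections")] -/
theorem pin_projLeft (I O : Finset σ) (ν : Finset (σ ⊕ τ) → ℝ) :
    pin I O (projLeft ν) = projLeft (pin (I.map Function.Embedding.inl) (O.map Function.Embedding.inl) ν) := by
  funext S
  rw [pin_apply, projLeft_apply, projLeft_apply]
  have hiff : ∀ T : Finset τ, (I.map Function.Embedding.inl ⊆ S.disjSum T ∧
      Disjoint (O.map Function.Embedding.inl) (S.disjSum T)) ↔ (I ⊆ S ∧ Disjoint O S) := by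
    intro T
    refine and_congr ⟨fun h x hx => ?_, fun h x hx => ?_⟩ ⟨fun h => ?_, fun h => ?_⟩
    · have := h (Finset.mem_map_of_mem _ hx)
      simpa using this
    · rw [Finset.mem_map] at hx
      obtain ⟨y, hy, rfl⟩ := hx
      simpa using h hy
    · rw [Finset.disjoint_left] at h ⊢
      intro x hxO hxS
      exact h (Finset.mem_map_of_mem _ hxO) (by simpa using hxS)
    · rw [Finset.disjoint_left] at h ⊢
      intro x hxO hxS
      rw [Finset.mem_map] at hxO
      obtain ⟨y, hy, rfl⟩ := hxO
      exact h hy (by simpa using hxS)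
  split_ifs with hc
  · exact Finset.sum_congr rfl fun T _ => by rw [pin_apply, if_pos ((hiff T).2 hc)]
  · exact (Finset.sum_eq_zero fun T _ => by rw [pin_apply, if_neg (fun h => hc ((hiff T).1 h))]).symm

omit [Fintype σ] [DecidableEq σ] [DecidableEq τ] in
/-- **External fields commute with projection** (field `1` on the hidden coordinates).
[cite: BorceaBrandenLiggett2007, §2.1 (ii), (iv); §4.2 ("closed under … projections, and external fields")] -/
theorem extField_projLeft (a : σ → ℝ) (ν : Finset (σ ⊕ τ) → ℝ) :
    extField a (projLeft ν) = projLeft (extField (Sum.elim a fun _ => 1) ν) := by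
  funext S
  rw [extField_apply, projLeft_apply, projLeft_apply, Finset.sum_mul]
  refine Finset.sum_congr rfl fun T _ => ?_
  rw [extField_apply, Finset.prod_disjSum]
  simp

omit [Fintype σ] [Fintype τ] in
/-- Lifting a function on `2^σ` through the projection keeps its dependency set. [cite: BorceaBrandenLiggett2007,
§4.2 proof of Thm. 4.9 ("negative association is closed under projections")] -/
theorem DeterminedBy.comp_toLeft_sum {F : Finset σ → ℝ} {E : Finset σ} (hF : DeterminedBy F E) :
    DeterminedBy (F ∘ (Finset.toLeft : Finset (σ ⊕ τ) → Finset σ)) (E.map Function.Embedding.inl) := by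
  intro U V hUV
  simp only [Function.comp_apply]
  refine hF _ _ ?_
  have h := congrArg Finset.toLeft hUV
  rw [Finset.toLeft_inter, Finset.toLeft_inter] at h
  have hE : (E.map Function.Embedding.inl : Finset (σ ⊕ τ)).toLeft = E := by
    ext x
    simp
  rwa [hE] at h

/-- **PHR** (BBL Def. 2.6): `μ` is the projection of a *homogeneous Rayleigh measure* — a nonnegative weight `ν`
on `2^{σ ⊔ τ}` (for some auxiliary finite type `τ` of hidden coordinates) which is homogeneous and Rayleigh, with
`projLeft ν = μ`. [cite: BorceaBrandenLiggett2007, §2.1 Def. 2.6 (homogeneous Rayleigh measures; the class PHR)] -/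
def IsPHR (μ : Finset σ → ℝ) : Prop :=
  ∃ (τ : Type u) (_ : Fintype τ) (_ : DecidableEq τ) (ν : Finset (σ ⊕ τ) → ℝ),
    (∀ U, 0 ≤ ν U) ∧ IsHomogeneous ν ∧ IsRayleigh ν ∧ projLeft ν = μ

omit [DecidableEq σ] in
/-- A PHR weight is nonnegative. [cite: BorceaBrandenLiggett2007, §2.1 Def. 2.6] -/
theorem IsPHR.nonneg {μ : Finset σ → ℝ} (h : IsPHR μ) (S : Finset σ) : 0 ≤ μ S := by
  obtain ⟨τ, _, _, ν, h0, -, -, rfl⟩ := h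
  exact projLeft_nonneg h0 S

/-- Transport of a weight on `2^σ` to `2^{σ ⊔ τ}` along the first summand (no hidden coordinates used). [folklore] -/
private def liftLeft (μ : Finset σ → ℝ) : Finset (σ ⊕ τ) → ℝ := fun U =>
  if U.toRight = ∅ then μ U.toLeft else 0

omit [Fintype σ] [DecidableEq σ] [Fintype τ] in
/-- The lifted weight on `S ⊔ T` is `μ(S)` if `T = ∅` and `0` otherwise. [folklore] -/
private theorem liftLeft_disjSum (μ : Finset σ → ℝ) (S : Finset σ) (T : Finset τ) :
    liftLeft μ (S.disjSum T) = if T = ∅ then μ S else 0 := by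
  simp [liftLeft, Finset.toLeft_disjSum, Finset.toRight_disjSum]

omit [DecidableEq σ] in
/-- The generating polynomial of the lifted weight is that of `μ` in the `σ`-variables. [folklore] -/
private theorem eval_multiAffine_liftLeft (μ : Finset σ → ℝ) (v : σ ⊕ τ → ℝ) :
    MvPolynomial.eval v (multiAffine (liftLeft μ)) = MvPolynomial.eval (v ∘ Sum.inl) (multiAffine μ) := by
  rw [eval_multiAffine, eval_multiAffine, sum_finset_sum_eq]
  refine Finset.sum_congr rfl fun S _ => ?_
  rw [Finset.sum_eq_single (∅ : Finset τ)]
  · rw [liftLeft_disjSum, if_pos rfl, Finset.prod_disjSum]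
    simp
  · intro T _ hT
    rw [liftLeft_disjSum, if_neg hT, zero_mul]
  · intro h
    exact absurd (Finset.mem_univ _) h

omit [Fintype σ] [Fintype τ] in
/-- `∂` in a `σ`-coordinate commutes with the lift. [folklore] -/
private theorem derivWeight_inl_liftLeft (i : σ) (μ : Finset σ → ℝ) :
    derivWeight (Sum.inl i : σ ⊕ τ) (liftLeft μ) = liftLeft (derivWeight i μ) := by
  funext U
  simp only [derivWeight_apply, liftLeft]
  have h1 : (insert (Sum.inl i : σ ⊕ τ) U).toRight = U.toRight := by
    ext x; simp
  have h2 : (insert (Sum.inl i : σ ⊕ τ) U).toLeft = insert i U.toLeft := by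
    ext x; simp
  simp only [h1, h2, Finset.mem_toLeft]
  split_ifs <;> rfl

omit [Fintype σ] [Fintype τ] in
/-- `∂` in a hidden coordinate kills the lift. [folklore] -/
private theorem derivWeight_inr_liftLeft (t : τ) (μ : Finset σ → ℝ) :
    derivWeight (Sum.inr t : σ ⊕ τ) (liftLeft μ) = 0 := by
  funext U
  rw [derivWeight_apply, Pi.zero_apply]
  split_ifs with h
  · rfl
  · simp only [liftLeft]
    rw [if_neg]
    intro hR
    have ht : t ∈ (insert (Sum.inr t : σ ⊕ τ) U).toRight := by simp
    rw [hR] at ht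
    exact Finset.notMem_empty _ ht

/-- The lift of a Rayleigh weight is Rayleigh. [folklore] -/
private theorem isRayleigh_liftLeft {μ : Finset σ → ℝ} (h : IsRayleigh μ) :
    IsRayleigh (liftLeft μ : Finset (σ ⊕ τ) → ℝ) := by
  rw [isRayleigh_iff] at h ⊢
  intro v hv i j
  have hv' : ∀ k, 0 < (v ∘ Sum.inl) k := fun k => hv _
  have h0 : multiAffine (0 : Finset (σ ⊕ τ) → ℝ) = 0 := by simp [multiAffine]
  rcases i with i | t
  · rcases j with j | t
    · rw [derivWeight_inl_liftLeft, derivWeight_inl_liftLeft, derivWeight_inl_liftLeft, eval_multiAffine_liftLeft,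
        eval_multiAffine_liftLeft, eval_multiAffine_liftLeft, eval_multiAffine_liftLeft]
      exact h _ hv' i j
    · rw [derivWeight_inr_liftLeft, derivWeight_zero]
      simp [h0]
  · rcases j with j | t'
    · rw [derivWeight_inl_liftLeft, derivWeight_inr_liftLeft, derivWeight_inr_liftLeft]
      simp [h0]
    · rw [derivWeight_inr_liftLeft t' μ, derivWeight_zero, derivWeight_inr_liftLeft t μ]
      simp [h0]

/-- **Homogeneous Rayleigh measures are PHR** (the trivial projection, no hidden coordinates).
[cite: BorceaBrandenLiggett2007, §2.1 Def. 2.6] -/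
theorem isPHR_of_isHomogeneous {μ : Finset σ → ℝ} (h : IsRayleigh μ) (h0 : ∀ S, 0 ≤ μ S) (hhom : IsHomogeneous μ) :
    IsPHR μ := by
  refine ⟨PEmpty.{u + 1}, inferInstance, inferInstance, liftLeft μ, fun U => ?_, ?_, isRayleigh_liftLeft h, ?_⟩
  · simp only [liftLeft]
    split_ifs
    · exact h0 _
    · exact le_rfl
  · obtain ⟨k, hk⟩ := hhom
    refine ⟨k, fun U hU => ?_⟩
    simp only [liftLeft] at hU
    split_ifs at hU with hR
    · have hUeq : U.toLeft.disjSum U.toRight = U := Finset.toLeft_disjSum_toRight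
      rw [← hUeq, Finset.card_disjSum, hR, Finset.card_empty, add_zero]
      exact hk _ hU
    · exact absurd rfl hU
  · funext S
    rw [projLeft_apply, Finset.sum_eq_single (∅ : Finset PEmpty.{u + 1})]
    · rw [liftLeft_disjSum, if_pos rfl]
    · intro T _ hT
      rw [liftLeft_disjSum, if_neg hT]
    · intro hc
      exact absurd (Finset.mem_univ _) hc

/-- **"Strongly Rayleigh measures belong to the class PHR"**: a nonnegative weight with stable (or zero)
generating polynomial is the projection of its symmetric homogenization `μ_sh` (Def. 2.12), which is homogeneous,
strongly Rayleigh (Thm. 4.2, tree `stableOrZero_symmHomog`) and therefore Rayleigh (Thm. 4.1).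
[cite: BorceaBrandenLiggett2007, §4.1 (sentence before Thm. 4.2) and Thm. 4.2] -/
theorem StableOrZero.isPHR {μ : Finset σ → ℝ} (h : StableOrZero μ) (h0 : ∀ S, 0 ≤ μ S) : IsPHR μ :=
  ⟨σ, inferInstance, inferInstance, symmHomog μ, symmHomog_nonneg h0, isHomogeneous_symmHomog μ,
    (stableOrZero_symmHomog h h0).isRayleigh, funext fun S => sum_symmHomog_disjSum μ S⟩

omit [Fintype σ] [DecidableEq σ] [Fintype τ] [DecidableEq τ] in
/-- Lifting through the projection keeps monotonicity. [folklore] -/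
private theorem monotone_comp_toLeft_sum {F : Finset σ → ℝ} (hF : Monotone F) :
    Monotone (F ∘ (Finset.toLeft : Finset (σ ⊕ τ) → Finset σ)) :=
  hF.comp Finset.toLeft_monotone

/-- **Borcea–Brändén–Liggett, Theorem 4.10 (negative association).** "If `μ ∈ 𝔓_n` is PHR then it is CNA+" —
the NA core: for a PHR weight, any two increasing functions depending on disjoint sets of coordinates satisfy
`E[FG] · μ(Ω) ≤ E[F] · E[G]`. Proof as indicated in the source: upstairs the homogeneous Rayleigh weight lies in the
Feder–Mihail class (Thm. 4.8), and negative association is closed under projections.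
[cite: BorceaBrandenLiggett2007, §4.2 Thm. 4.10] -/
theorem IsPHR.negAssoc {μ : Finset σ → ℝ} (h : IsPHR μ) {F G : Finset σ → ℝ} (hF : Monotone F) (hG : Monotone G)
    {E₁ E₂ : Finset σ} (hFE : DeterminedBy F E₁) (hGE : DeterminedBy G E₂) (hdisj : Disjoint E₁ E₂) :
    ex μ (F * G) * mass μ ≤ ex μ F * ex μ G := by
  obtain ⟨τ, _, _, ν, h0, hhom, hR, rfl⟩ := h
  have key := federMihail_negAssoc (hR.isFederMihail h0 hhom) (monotone_comp_toLeft_sum hF)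
    (monotone_comp_toLeft_sum hG) (hFE.comp_toLeft_sum (τ := τ)) (hGE.comp_toLeft_sum (τ := τ))
    ((Finset.disjoint_map _).2 hdisj)
  rwa [show ((F ∘ Finset.toLeft) * (G ∘ Finset.toLeft) : Finset (σ ⊕ τ) → ℝ) = (F * G) ∘ Finset.toLeft from rfl,
    ← ex_projLeft, ← ex_projLeft, ← ex_projLeft, ← mass_projLeft] at key

/-- **PHR is closed under conditioning** (conditioning commutes with the projection and keeps "nonnegative
homogeneous Rayleigh" upstairs). [cite: BorceaBrandenLiggett2007, §4.2 (before Thm. 4.10: "the Rayleigh/h-NLC+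
property is also closed under conditioning, projections, and external fields")] -/
theorem isPHR_pin {μ : Finset σ → ℝ} (h : IsPHR μ) (I O : Finset σ) : IsPHR (pin I O μ) := by
  obtain ⟨τ, _, _, ν, h0, hhom, hR, rfl⟩ := h
  refine ⟨τ, inferInstance, inferInstance, pin (I.map Function.Embedding.inl) (O.map Function.Embedding.inl) ν,
    pin_nonneg h0 _ _, ((hR.isFederMihail h0 hhom).pin _ _).homogeneous, isRayleigh_pin hR _ _, (pin_projLeft I O ν).symm⟩

/-- **PHR is closed under external fields** (`a_i ≥ 0`; field `1` on the hidden coordinates).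
[cite: BorceaBrandenLiggett2007, §4.2 (before Thm. 4.10); §2.1 Prop. 2.1 (4)] -/
theorem isPHR_extField {μ : Finset σ → ℝ} (h : IsPHR μ) {a : σ → ℝ} (ha : ∀ i, 0 ≤ a i) : IsPHR (extField a μ) := by
  obtain ⟨τ, _, _, ν, h0, hhom, hR, rfl⟩ := h
  have ha' : ∀ k : σ ⊕ τ, 0 ≤ Sum.elim a (fun _ => (1 : ℝ)) k := by
    rintro (k | k)
    · exact ha k
    · exact zero_le_one
  exact ⟨τ, inferInstance, inferInstance, extField (Sum.elim a fun _ => 1) ν, extField_nonneg h0 ha',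
    isHomogeneous_extField hhom _, isRayleigh_extField hR ha', (extField_projLeft a ν).symm⟩

/-- **Borcea–Brändén–Liggett, Theorem 4.10 (CNA+).** "If `μ ∈ 𝔓_n` is PHR then it is CNA+": every weight
obtained from a PHR weight by imposing an external field (`a_i ≥ 0`) and conditioning is negatively associated —
for increasing `F`, `G` depending on disjoint coordinate sets, `E[FG] · (Ω) ≤ E[F] · E[G]` under
`pin I O (extField a μ)`. (Projections onto `E ⊆ σ` need no separate clause: conditioning on coordinates of `E`
and fields commute with the projection — `pin_projLeft`, `extField_projLeft` — and NA of the projection is NA of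
the weight for functions determined inside `E`.) [cite: BorceaBrandenLiggett2007, §4.2 Thm. 4.10; §2.1 Def. 2.7
(CNA+)] -/
theorem IsPHR.negAssoc_pin_extField {μ : Finset σ → ℝ} (h : IsPHR μ) {a : σ → ℝ} (ha : ∀ i, 0 ≤ a i)
    (I O : Finset σ) {F G : Finset σ → ℝ} (hF : Monotone F) (hG : Monotone G) {E₁ E₂ : Finset σ}
    (hFE : DeterminedBy F E₁) (hGE : DeterminedBy G E₂) (hdisj : Disjoint E₁ E₂) :
    ex (pin I O (extField a μ)) (F * G) * mass (pin I O (extField a μ)) ≤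
      ex (pin I O (extField a μ)) F * ex (pin I O (extField a μ)) G :=
  (isPHR_pin (isPHR_extField h ha) I O).negAssoc hF hG hFE hGE hdisj

/-- Theorem 4.10 for probability weights: `E[FG] ≤ E[F] E[G]`. [cite: BorceaBrandenLiggett2007, §4.2 Thm. 4.10;
§2.1 Def. 2.7] -/
theorem IsPHR.negAssoc_of_mass_eq_one {μ : Finset σ → ℝ} (h : IsPHR μ) (h1 : mass μ = 1) {F G : Finset σ → ℝ}
    (hF : Monotone F) (hG : Monotone G) {E₁ E₂ : Finset σ} (hFE : DeterminedBy F E₁) (hGE : DeterminedBy G E₂)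
    (hdisj : Disjoint E₁ E₂) : ex μ (F * G) ≤ ex μ F * ex μ G := by
  have key := h.negAssoc hF hG hFE hGE hdisj
  rwa [h1, mul_one] at key

/-- Theorem 4.10 for increasing events: `μ(𝒜 ∩ ℬ) μ(Ω) ≤ μ(𝒜) μ(ℬ)` for up-sets depending on disjoint
coordinate sets. [cite: BorceaBrandenLiggett2007, §4.2 Thm. 4.10; §2.1 (negatively associated events)] -/
theorem IsPHR.negAssoc_events {μ : Finset σ → ℝ} (h : IsPHR μ) {𝒜 ℬ : Finset (Finset σ)}
    (h𝒜 : IsUpperSet (𝒜 : Set (Finset σ))) (hℬ : IsUpperSet (ℬ : Set (Finset σ))) {E₁ E₂ : Finset σ}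
    (h𝒜E : DeterminedBy (setInd 𝒜) E₁) (hℬE : DeterminedBy (setInd ℬ) E₂) (hdisj : Disjoint E₁ E₂) :
    (∑ S ∈ 𝒜 ∩ ℬ, μ S) * mass μ ≤ (∑ S ∈ 𝒜, μ S) * ∑ S ∈ ℬ, μ S := by
  have key := h.negAssoc (monotone_setInd h𝒜) (monotone_setInd hℬ) h𝒜E hℬE hdisj
  have hex : ∀ 𝒞 : Finset (Finset σ), ex μ (setInd 𝒞) = ∑ S ∈ 𝒞, μ S := fun 𝒞 => by
    simp only [ex, setInd_apply, mul_ite, mul_one, mul_zero]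
    rw [Finset.sum_ite_mem, Finset.univ_inter]
  rwa [setInd_mul, hex, hex, hex] at key

/-- **Theorem 4.9 from Theorem 4.10**: the tree's "strongly Rayleigh ⇒ CNA+" (`StableOrZero.negAssoc_pin_extField`)
is the special case of PHR weights coming from Thm. 4.2. [cite: BorceaBrandenLiggett2007, §4.2 Thm. 4.9, Thm. 4.10
("the following stronger version of Theorem 4.9")] -/
theorem StableOrZero.negAssoc_pin_extField_of_isPHR {μ : Finset σ → ℝ} (h : StableOrZero μ) (h0 : ∀ S, 0 ≤ μ S)
    {a : σ → ℝ} (ha : ∀ i, 0 ≤ a i) (I O : Finset σ) {F G : Finset σ → ℝ} (hF : Monotone F) (hG : Monotone G)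
    {E₁ E₂ : Finset σ} (hFE : DeterminedBy F E₁) (hGE : DeterminedBy G E₂) (hdisj : Disjoint E₁ E₂) :
    ex (pin I O (extField a μ)) (F * G) * mass (pin I O (extField a μ)) ≤
      ex (pin I O (extField a μ)) F * ex (pin I O (extField a μ)) G :=
  (h.isPHR h0).negAssoc_pin_extField ha I O hF hG hFE hGE hdisj

/-! ### Transport along an equivalence of ground sets; PHR is closed under projections -/

section Transport

variable {α β : Type u} [Fintype α] [Fintype β] [DecidableEq α] [DecidableEq β]

/-- Transport of a weight along an equivalence of ground sets (relabelling the coordinates). [folklore] -/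
private def transportW (e : α ≃ β) (ν : Finset α → ℝ) : Finset β → ℝ := fun W => ν (W.map e.symm.toEmbedding)

omit [Fintype α] [Fintype β] [DecidableEq α] [DecidableEq β] in
/-- Unfolding `transportW`. [folklore] -/
private theorem transportW_apply (e : α ≃ β) (ν : Finset α → ℝ) (W : Finset β) :
    transportW e ν W = ν (W.map e.symm.toEmbedding) := rfl

omit [Fintype α] [Fintype β] [DecidableEq α] [DecidableEq β] in
/-- `(U.map e).map e⁻¹ = U`. [folklore] -/
private theorem map_map_symm (e : α ≃ β) (U : Finset α) : (U.map e.toEmbedding).map e.symm.toEmbedding = U := by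
  ext x
  simp [Finset.mem_map_equiv]

omit [DecidableEq α] [DecidableEq β] in
/-- Relabelling the coordinates relabels the variables of the generating polynomial. [folklore] -/
private theorem eval_multiAffine_transportW (e : α ≃ β) (ν : Finset α → ℝ) (v : β → ℝ) :
    MvPolynomial.eval v (multiAffine (transportW e ν)) = MvPolynomial.eval (v ∘ e) (multiAffine ν) := by
  classical
  rw [eval_multiAffine, eval_multiAffine]
  refine (Fintype.sum_equiv e.finsetCongr _ _ fun U => ?_).symm
  rw [Equiv.finsetCongr_apply, transportW_apply, map_map_symm, Finset.prod_map]
  rfl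

omit [Fintype α] [Fintype β] in
/-- Derivative weights commute with relabelling. [folklore] -/
private theorem derivWeight_transportW (e : α ≃ β) (a : α) (ν : Finset α → ℝ) :
    derivWeight (e a) (transportW e ν) = transportW e (derivWeight a ν) := by
  funext W
  simp only [derivWeight_apply, transportW_apply, Finset.map_insert, Finset.mem_map_equiv, Equiv.symm_symm,
    Equiv.coe_toEmbedding, Equiv.symm_apply_apply]

/-- Relabelling the coordinates keeps the Rayleigh property. [folklore] -/
private theorem isRayleigh_transportW (e : α ≃ β) {ν : Finset α → ℝ} (h : IsRayleigh ν) :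
    IsRayleigh (transportW e ν) := by
  rw [isRayleigh_iff] at h ⊢
  intro v hv i j
  rw [← e.apply_symm_apply i, ← e.apply_symm_apply j, derivWeight_transportW, derivWeight_transportW,
    derivWeight_transportW, eval_multiAffine_transportW, eval_multiAffine_transportW, eval_multiAffine_transportW,
    eval_multiAffine_transportW]
  exact h (v ∘ e) (fun k => hv _) _ _

omit [Fintype α] [Fintype β] [DecidableEq α] [DecidableEq β] in
/-- Relabelling the coordinates keeps homogeneity. [folklore] -/
private theorem isHomogeneous_transportW (e : α ≃ β) {ν : Finset α → ℝ} (h : IsHomogeneous ν) :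
    IsHomogeneous (transportW e ν) := by
  obtain ⟨k, hk⟩ := h
  exact ⟨k, fun W hW => by rw [← Finset.card_map e.symm.toEmbedding]; exact hk _ hW⟩

end Transport

variable {τ' : Type u} [Fintype τ'] [DecidableEq τ']

omit [Fintype σ] [DecidableEq σ] [DecidableEq τ] [DecidableEq τ'] in
/-- Iterated projections: projecting `2^{(σ ⊔ τ) ⊔ τ'} → 2^{σ ⊔ τ} → 2^σ` is the projection
`2^{σ ⊔ (τ ⊔ τ')} → 2^σ` after re-associating the ground set. [cite: BorceaBrandenLiggett2007, §2.1 (ii)] -/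
private theorem projLeft_transportW_sumAssoc (ρ : Finset ((σ ⊕ τ) ⊕ τ') → ℝ) :
    projLeft (transportW (Equiv.sumAssoc σ τ τ') ρ) = projLeft (projLeft ρ) := by
  classical
  funext S
  rw [projLeft_apply, projLeft_apply, sum_finset_sum_eq]
  refine Finset.sum_congr rfl fun T _ => ?_
  rw [projLeft_apply]
  refine Finset.sum_congr rfl fun T' _ => ?_
  rw [transportW_apply]
  congr 1
  ext x
  rcases x with ((s | t) | t') <;> simp [Finset.mem_map_equiv]

/-- **PHR is closed under projections** (a projection of a projection of a homogeneous Rayleigh measure is a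
projection of it). [cite: BorceaBrandenLiggett2007, §2.1 Def. 2.6; §4.2 (before Thm. 4.10: "closed under …
projections")] -/
theorem isPHR_projLeft {ν : Finset (σ ⊕ τ) → ℝ} (h : IsPHR ν) : IsPHR (projLeft ν) := by
  obtain ⟨τ', _, _, ρ, h0, hhom, hR, rfl⟩ := h
  exact ⟨τ ⊕ τ', inferInstance, inferInstance, transportW (Equiv.sumAssoc σ τ τ') ρ, fun W => h0 _,
    isHomogeneous_transportW _ hhom, isRayleigh_transportW _ hR, projLeft_transportW_sumAssoc ρ⟩

/-- **Theorem 4.10 (CNA+) with an explicit projection**: a projection of a PHR weight, with an external field and a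
conditioning imposed, is negatively associated. [cite: BorceaBrandenLiggett2007, §4.2 Thm. 4.10; §2.1 Def. 2.7] -/
theorem IsPHR.negAssoc_projLeft_pin_extField {ν : Finset (σ ⊕ τ) → ℝ} (h : IsPHR ν) {a : σ → ℝ} (ha : ∀ i, 0 ≤ a i)
    (I O : Finset σ) {F G : Finset σ → ℝ} (hF : Monotone F) (hG : Monotone G) {E₁ E₂ : Finset σ}
    (hFE : DeterminedBy F E₁) (hGE : DeterminedBy G E₂) (hdisj : Disjoint E₁ E₂) :
    ex (pin I O (extField a (projLeft ν))) (F * G) * mass (pin I O (extField a (projLeft ν))) ≤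
      ex (pin I O (extField a (projLeft ν))) F * ex (pin I O (extField a (projLeft ν))) G :=
  (isPHR_projLeft h).negAssoc_pin_extField ha I O hF hG hFE hGE hdisj

end PHR

end Literature.Probability.NegativeDependence

end
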